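import Summits.BirchSwinnertonDyer.BirchSwinnertonDyer.Theorems.ManinLocalTwoThreeKatoShiftTwoMultiShift
import Summits.BirchSwinnertonDyer.BirchSwinnertonDyer.Theorems.AdditiveKolyvaginRoadManinFrameResidueProperRTameTwistFullEuler
import Summits.BirchSwinnertonDyer.BirchSwinnertonDyer.Theorems.AdditiveKolyvaginRoadManinFrameResidueProperRTameTwistCharacter
import Mathlib.NumberTheory.LegendreSymbol.Basic

/-!
# Route `ManinLocalTwoThree`, crux C2 `ManinOddAtFour` (stmt-BirchSwinnertonDyer-22967), line `kato-shift-two`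
# (es g7), stub `stub_two_dvd_multiShiftClass`: admissible primes `ℓ ≡ 3 (mod 4)` at `p = 2` — even
# characters have ODD order, are primitive when `≠ 1`, the symmetrised Euler factors at the odd `q ∥ N` are
# `2`-units OFF the holes `χ(q) = 1`; and the multi-shift transform indexed by an arbitrary family of units
# (line prover p1; helper)

* `orderOf_dvd_div_two_of_even`, `not_two_dvd_orderOf_of_even` — an EVEN character modulo a prime
  `ℓ ≡ 3 (mod 4)` satisfies `χ^{(ℓ−1)/2} = 1`, so its order is odd (Euler: `a^{(ℓ−1)/2} = ±1`);
* `isPrimitive_of_ne_one` — `χ ≠ 1` mod a prime is primitive;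
* `pow_orderOf_apply_eq_one` — `χ(q)^{ord χ} = 1` for a unit `q`;
* `exists_symmEulerFactor_mul_eq_two` — for an odd prime `q`, `a ∈ {1, −1, 0}`, `χ` of odd order with
  `χ(q) ≠ 1`: `(q − aχ(q))(q − aχ(q)⁻¹)·w = t`, `w` integral, `t` odd (resonant case of bsd-wall's
  `exists_symmEulerFactor_mul_eq_of_modEq` at `p = 2`; `a = 0` gives `q²`);
* `charSum_multiShift'`, `two_dvd_multiShift_of_pint'` — the multi-shift transform and punch of
  `…KatoShiftTwoMultiShift` for a family of units `g : ι → (ℤ/ℓ)ˣ` indexed by any finite set (the line indexes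
  the hole generators by the NATURAL numbers `8` and `q ∥ N`, which need not be distinct mod `ℓ`).
Nothing about BSD or Manin's conjecture is proved here.
-/

set_option autoImplicit false
set_option linter.dupNamespace false

noncomputable section

open scoped Classical

open Summit.BirchSwinnertonDyer.BirchSwinnertonDyer.Theorems.ManinFrameResidueProperRTameTwist

namespace Summit.BirchSwinnertonDyer.BirchSwinnertonDyer.Theorems.ManinLocalTwoThree

section EvenCharacters

variable {ℓ : ℕ} [hℓ : Fact ℓ.Prime]

/-- **An even character modulo a prime has `χ^{(ℓ−1)/2} = 1`** (Euler: every unit `a` has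
`a^{(ℓ−1)/2} = ±1`, and `χ(±1) = 1`). [folklore] -/
theorem pow_div_two_eq_one_of_even {χ : DirichletCharacter ℂ ℓ} (hχ : χ.Even) : χ ^ (ℓ / 2) = 1 := by
  refine MulChar.ext fun a ↦ ?_
  rw [MulChar.pow_apply_coe, MulChar.one_apply_coe, ← map_pow, ← Units.val_pow_eq_pow_val]
  have ha : ((a : ZMod ℓ)) ≠ 0 := a.ne_zero
  rcases ZMod.pow_div_two_eq_neg_one_or_one ℓ ha with h | h
  · rw [Units.val_pow_eq_pow_val, h, map_one]
  · rw [Units.val_pow_eq_pow_val, h]; exact hχ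

/-- **Even characters modulo a prime `ℓ ≡ 3 (mod 4)` have odd order** (`ord χ ∣ (ℓ−1)/2`, odd).
[folklore] -/
theorem not_two_dvd_orderOf_of_even (h4 : ℓ % 4 = 3) {χ : DirichletCharacter ℂ ℓ} (hχ : χ.Even) :
    ¬ 2 ∣ orderOf χ := by
  intro h2
  have hdvd : orderOf χ ∣ ℓ / 2 := orderOf_dvd_of_pow_eq_one (pow_div_two_eq_one_of_even hχ)
  have : 2 ∣ ℓ / 2 := h2.trans hdvd
  omega

/-- A non-trivial character modulo a prime is primitive. [folklore] -/
theorem isPrimitive_of_ne_one {χ : DirichletCharacter ℂ ℓ} (hχ1 : χ ≠ 1) : χ.IsPrimitive := by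
  rw [DirichletCharacter.isPrimitive_def]
  rcases (Nat.dvd_prime hℓ.out).mp (DirichletCharacter.conductor_dvd_level χ) with h | h
  · exact absurd (DirichletCharacter.eq_one_iff_conductor_eq_one.mpr h) hχ1
  · exact h

/-- `χ(q)^{ord χ} = 1` for a unit `q`. [folklore] -/
theorem pow_orderOf_apply_eq_one (χ : DirichletCharacter ℂ ℓ) (q : (ZMod ℓ)ˣ) :
    χ (q : ZMod ℓ) ^ orderOf χ = 1 := by
  rw [← MulChar.pow_apply_coe, pow_orderOf_eq_one, MulChar.one_apply_coe]

/-- **The symmetrised Euler factor at an odd `q ∥ N` is a `2`-unit off the hole**: `q` an odd prime,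
`a ∈ {1, −1, 0}`, `χ` of odd order with `χ(q) ≠ 1` (and `q` a unit mod `ℓ`):
`(q − aχ(q))(q − aχ(q)⁻¹)·w = t` with `w` integral and `t` odd. [folklore] -/
theorem exists_symmEulerFactor_mul_eq_two {q : ℕ} (hq : q.Prime) (hq2 : q ≠ 2)
    (hqℓ : IsUnit (q : ZMod ℓ)) {a : ℤ} (ha : a = 1 ∨ a = -1 ∨ a = 0) {χ : DirichletCharacter ℂ ℓ}
    (hord : ¬ 2 ∣ orderOf χ) (hχq : χ (q : ZMod ℓ) ≠ 1) :
    ∃ (w : ℂ) (t : ℤ), IsIntegral ℤ w ∧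
      (((q : ℂ) - (a : ℂ) * χ (q : ZMod ℓ)) * ((q : ℂ) - (a : ℂ) * (χ (q : ZMod ℓ))⁻¹)) * w = t ∧
        ¬ ((2 : ℕ) : ℤ) ∣ t := by
  haveI : Fact (Nat.Prime 2) := ⟨Nat.prime_two⟩
  have hqodd : ¬ 2 ∣ q := fun h ↦ hq2 ((Nat.prime_dvd_prime_iff_eq Nat.prime_two hq).mp h).symm
  rcases ha with h1 | h1 | h0
  · -- a = 1
    have hmod : ((2 : ℕ) : ℤ) ∣ (q : ℤ) - a := by rw [h1]; omega
    have hne : (q : ℤ) ≠ a := by rw [h1]; exact_mod_cast hq.one_lt.ne'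
    obtain ⟨u, hu⟩ := hqℓ
    have hζ : χ (q : ZMod ℓ) ^ orderOf χ = 1 := by rw [← hu]; exact pow_orderOf_apply_eq_one χ u
    exact exists_symmEulerFactor_mul_eq_of_modEq (p := 2) q a hmod (by rw [h1]; omega) hne
      (orderOf_pos χ) (by exact_mod_cast hord) hζ hχq
  · -- a = -1
    have hmod : ((2 : ℕ) : ℤ) ∣ (q : ℤ) - a := by rw [h1]; omega
    have hne : (q : ℤ) ≠ a := by rw [h1]; have := hq.pos; omega
    obtain ⟨u, hu⟩ := hqℓ
    have hζ : χ (q : ZMod ℓ) ^ orderOf χ = 1 := by rw [← hu]; exact pow_orderOf_apply_eq_one χ u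
    exact exists_symmEulerFactor_mul_eq_of_modEq (p := 2) q a hmod (by rw [h1]; omega) hne
      (orderOf_pos χ) (by exact_mod_cast hord) hζ hχq
  · -- a = 0: the factor is `q²`
    refine ⟨1, (q : ℤ) ^ 2, isIntegral_one, ?_, ?_⟩
    · rw [h0]; push_cast; ring
    · intro h
      have h' : (2 : ℤ) ∣ (q : ℤ) := Int.Prime.dvd_pow' Nat.prime_two (by exact_mod_cast h)
      exact hqodd (by exact_mod_cast h')

end EvenCharacters

/-! ### The multi-shift transform for an indexed family of units -/

section MultiShiftFamily

variable {ℓ : ℕ} [NeZero ℓ] {ι : Type*}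

/-- **The multi-shift transform, indexed form**: for a finite index set `s`, units `g i`, and
`y(v) = Σ_{T ⊆ s} (−1)^{|T|} x(v·∏_{i∈T} g i)`:
`Σ_v χ(v) y(v) = (∏_{i∈s} (1 − χ((g i)⁻¹))) · Σ_w χ(w) x(w)`. [folklore] -/
theorem charSum_multiShift' (x : ZMod ℓ → ℂ) (χ : DirichletCharacter ℂ ℓ) (s : Finset ι)
    (g : ι → (ZMod ℓ)ˣ) :
    ∑ v : ZMod ℓ, χ v * (∑ T ∈ s.powerset, (-1 : ℂ) ^ T.card *
        x (v * ((∏ i ∈ T, g i : (ZMod ℓ)ˣ) : ZMod ℓ))) =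
      (∏ i ∈ s, (1 - χ (((g i)⁻¹ : (ZMod ℓ)ˣ) : ZMod ℓ))) * ∑ w : ZMod ℓ, χ w * x w := by
  have h1 : ∑ v : ZMod ℓ, χ v * (∑ T ∈ s.powerset, (-1 : ℂ) ^ T.card *
        x (v * ((∏ i ∈ T, g i : (ZMod ℓ)ˣ) : ZMod ℓ))) =
      ∑ T ∈ s.powerset, (-1 : ℂ) ^ T.card *
        (χ (((∏ i ∈ T, g i)⁻¹ : (ZMod ℓ)ˣ) : ZMod ℓ) * ∑ w : ZMod ℓ, χ w * x w) := by
    simp only [Finset.mul_sum]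
    rw [Finset.sum_comm]
    refine Finset.sum_congr rfl fun T _ ↦ ?_
    have hs := sum_char_mul_shift x χ (∏ i ∈ T, g i)
    calc ∑ v : ZMod ℓ, χ v * ((-1 : ℂ) ^ T.card * x (v * ((∏ i ∈ T, g i : (ZMod ℓ)ˣ) : ZMod ℓ)))
        = (-1 : ℂ) ^ T.card * ∑ v : ZMod ℓ, χ v * x (v * ((∏ i ∈ T, g i : (ZMod ℓ)ˣ) : ZMod ℓ)) := by
          rw [Finset.mul_sum]; exact Finset.sum_congr rfl fun v _ ↦ by ring
      _ = ∑ w : ZMod ℓ, (-1 : ℂ) ^ T.card *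
            (χ (((∏ i ∈ T, g i)⁻¹ : (ZMod ℓ)ˣ) : ZMod ℓ) * (χ w * x w)) := by
          rw [hs, Finset.mul_sum, Finset.mul_sum]
  rw [h1]
  have h2 : ∀ T ∈ s.powerset, (-1 : ℂ) ^ T.card *
      (χ (((∏ i ∈ T, g i)⁻¹ : (ZMod ℓ)ˣ) : ZMod ℓ) * ∑ w : ZMod ℓ, χ w * x w) =
      (∏ i ∈ T, (-χ (((g i)⁻¹ : (ZMod ℓ)ˣ) : ZMod ℓ))) * ∑ w : ZMod ℓ, χ w * x w := by
    intro T _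
    have hprod : χ (((∏ i ∈ T, g i)⁻¹ : (ZMod ℓ)ˣ) : ZMod ℓ) =
        ∏ i ∈ T, χ (((g i)⁻¹ : (ZMod ℓ)ˣ) : ZMod ℓ) := by
      rw [← Finset.prod_inv_distrib, Units.coe_prod, map_prod]
    rw [hprod, Finset.prod_neg, ← mul_assoc]
  rw [Finset.sum_congr rfl h2, ← Finset.sum_mul, ← Finset.prod_one_add]
  refine congrArg (· * _) (Finset.prod_congr rfl fun t _ ↦ by ring)

omit [NeZero ℓ] in
/-- A hole kills the indexed transform. [folklore] -/
theorem prod_one_sub_eq_zero_of_hole' (χ : DirichletCharacter ℂ ℓ) (s : Finset ι) (g : ι → (ZMod ℓ)ˣ)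
    {i : ι} (hi : i ∈ s) (h1 : χ (g i : ZMod ℓ) = 1) :
    ∏ i ∈ s, (1 - χ (((g i)⁻¹ : (ZMod ℓ)ˣ) : ZMod ℓ)) = 0 := by
  refine Finset.prod_eq_zero hi ?_
  rw [(apply_inv_eq_one_iff (g i) χ).mpr h1, sub_self]

end MultiShiftFamily

section PunchFamily

variable {ℓ : ℕ} [hℓ : Fact ℓ.Prime] {ι : Type*}

/-- **`2 ∣ y(u)` for the indexed multi-shift coordinates** (as `two_dvd_multiShift_of_pint`, for a family
of units `g : ι → (ℤ/ℓ)ˣ` over a finite index set `s`): `x` even integer-valued, `ℓ ≡ 3 (mod 4)`, and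
`(Σ_w χ(w)x(w))/4` `2`-integral for every EVEN `χ` with `χ(g i) ≠ 1` for all `i ∈ s` ⟹
`2 ∣ Σ_{T ⊆ s} (−1)^{|T|} x(u·∏_{i∈T} g i)` for every unit `u`. [folklore] -/
theorem two_dvd_multiShift_of_pint' (h4 : ℓ % 4 = 3) (x : ZMod ℓ → ℤ) (heven : ∀ a, x (-a) = x a)
    (s : Finset ι) (g : ι → (ZMod ℓ)ˣ)
    (hA : ∀ χ : DirichletCharacter ℂ ℓ, χ.Even → (∀ i ∈ s, χ (g i : ZMod ℓ) ≠ 1) →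
      ∃ n : ℕ, ¬ 2 ∣ n ∧ IsIntegral ℤ ((n : ℂ) * ((∑ w : ZMod ℓ, χ w * (x w : ℂ)) / 4)))
    (u : (ZMod ℓ)ˣ) :
    (2 : ℤ) ∣ ∑ T ∈ s.powerset, (-1 : ℤ) ^ T.card *
      x ((u : ZMod ℓ) * ((∏ i ∈ T, g i : (ZMod ℓ)ˣ) : ZMod ℓ)) := by
  haveI : NeZero ℓ := ⟨hℓ.out.ne_zero⟩
  set y : ZMod ℓ → ℤ := fun v ↦
    ∑ T ∈ s.powerset, (-1 : ℤ) ^ T.card * x (v * ((∏ i ∈ T, g i : (ZMod ℓ)ˣ) : ZMod ℓ)) with hydef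
  have hyeven : ∀ v, y (-v) = y v := by
    intro v
    simp only [hydef]
    refine Finset.sum_congr rfl fun T _ ↦ ?_
    rw [neg_mul, heven]
  set yc : ZMod ℓ → ℂ := fun v ↦ (y v : ℂ) with hyc
  have hyc_eq : ∀ v, yc v = ∑ T ∈ s.powerset, (-1 : ℂ) ^ T.card *
      (fun w : ZMod ℓ ↦ (x w : ℂ)) (v * ((∏ i ∈ T, g i : (ZMod ℓ)ˣ) : ZMod ℓ)) := by
    intro v; simp only [hyc, hydef]; push_cast; rfl
  have htrans : ∀ χ : DirichletCharacter ℂ ℓ,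
      ∑ v : ZMod ℓ, χ v * yc v =
        (∏ i ∈ s, (1 - χ (((g i)⁻¹ : (ZMod ℓ)ˣ) : ZMod ℓ))) * ∑ w : ZMod ℓ, χ w * (x w : ℂ) := by
    intro χ
    simp_rw [hyc_eq]
    exact charSum_multiShift' (fun w ↦ (x w : ℂ)) χ s g
  have hpint : ∀ χ : DirichletCharacter ℂ ℓ, χ.Even →
      ∃ n : ℕ, ¬ 2 ∣ n ∧ IsIntegral ℤ ((n : ℂ) * (χ (u : ZMod ℓ)⁻¹ * ((∑ v : ZMod ℓ, χ v * yc v) / 4))) := by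
    intro χ hχ
    refine pint_mul Nat.prime_two (pint_of_isIntegral Nat.prime_two
      (isIntegral_dirichletCharacter_apply χ _)) ?_
    rw [htrans χ, mul_div_assoc]
    by_cases hhole : ∃ i ∈ s, χ (g i : ZMod ℓ) = 1
    · obtain ⟨i, hi, h1⟩ := hhole
      rw [prod_one_sub_eq_zero_of_hole' χ s g hi h1, zero_mul]
      exact pint_of_isIntegral Nat.prime_two isIntegral_zero
    · push Not at hhole
      refine pint_mul Nat.prime_two (pint_of_isIntegral Nat.prime_two ?_) (hA χ hχ hhole)
      refine IsIntegral.prod _ fun t _ ↦ ?_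
      exact isIntegral_one.sub (isIntegral_dirichletCharacter_apply χ _)
  have hsum : ∃ n : ℕ, ¬ 2 ∣ n ∧ IsIntegral ℤ ((n : ℂ) *
      ∑ χ ∈ (Finset.univ : Finset (DirichletCharacter ℂ ℓ)) with χ.Even,
        χ (u : ZMod ℓ)⁻¹ * ((∑ v : ZMod ℓ, χ v * yc v) / 4)) :=
    pint_sum Nat.prime_two _ _ fun χ hχ ↦ hpint χ (Finset.mem_filter.mp hχ).2
  have horth := two_mul_sum_even_char_weighted yc (u : ZMod ℓ) (Units.isUnit u)
  have hycu : yc (-(u : ZMod ℓ)) = yc u := by simp only [hyc, hyeven]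
  rw [hycu] at horth
  have horth' : ∑ χ ∈ (Finset.univ : Finset (DirichletCharacter ℂ ℓ)) with χ.Even,
      χ (u : ZMod ℓ)⁻¹ * (∑ v : ZMod ℓ, χ v * yc v) = (ℓ.totient : ℂ) * yc u := by
    have h2 : (2 : ℂ) ≠ 0 := two_ne_zero
    apply mul_left_cancel₀ h2
    rw [horth]; ring
  have hsum_eq : ∑ χ ∈ (Finset.univ : Finset (DirichletCharacter ℂ ℓ)) with χ.Even,
      χ (u : ZMod ℓ)⁻¹ * ((∑ v : ZMod ℓ, χ v * yc v) / 4) =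
      (((((ℓ.totient : ℤ)) * y u : ℤ) : ℚ) / 4 : ℚ) := by
    have h2 : ∑ χ ∈ (Finset.univ : Finset (DirichletCharacter ℂ ℓ)) with χ.Even,
        χ (u : ZMod ℓ)⁻¹ * ((∑ v : ZMod ℓ, χ v * yc v) / 4) =
        (∑ χ ∈ (Finset.univ : Finset (DirichletCharacter ℂ ℓ)) with χ.Even,
          χ (u : ZMod ℓ)⁻¹ * (∑ v : ZMod ℓ, χ v * yc v)) / 4 := by
      rw [Finset.sum_div]
      exact Finset.sum_congr rfl fun _ _ ↦ by ring
    rw [h2, horth', hyc]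
    push_cast
    ring
  rw [hsum_eq] at hsum
  have hval := padicValRat_nonneg_of_pint (p := 2) hsum
  have hφ : (ℓ.totient : ℤ) = 2 * ((ℓ / 2 : ℕ) : ℤ) := by
    rw [Nat.totient_prime hℓ.out]
    have : ℓ - 1 = 2 * (ℓ / 2) := by omega
    rw [this]; push_cast; ring
  have hodd : ¬ (2 : ℤ) ∣ ((ℓ / 2 : ℕ) : ℤ) := by
    intro h
    have : 2 ∣ ℓ / 2 := by exact_mod_cast h
    omega
  show (2 : ℤ) ∣ y u
  by_contra hyu
  set K : ℤ := (ℓ.totient : ℤ) * y u with hK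
  have hK2 : ¬ (4 : ℤ) ∣ K := by
    intro h4'
    rw [hK, hφ, mul_assoc, show (4 : ℤ) = 2 * 2 by norm_num] at h4'
    have h2 : (2 : ℤ) ∣ ((ℓ / 2 : ℕ) : ℤ) * y u := (mul_dvd_mul_iff_left two_ne_zero).mp h4'
    rcases Int.Prime.dvd_mul' Nat.prime_two h2 with h | h
    · exact hodd h
    · exact hyu h
  have hK0 : K ≠ 0 := by
    rintro h; exact hK2 (h ▸ dvd_zero 4)
  have h4v : padicValRat 2 (4 : ℚ) = 2 := by
    have : (4 : ℚ) = (2 : ℚ) ^ (2 : ℕ) := by norm_num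
    rw [this, padicValRat.pow (p := 2) (2 : ℚ)]
    have h22 : padicValRat 2 (2 : ℚ) = 1 := by exact_mod_cast padicValRat.self (p := 2) one_lt_two
    rw [h22]; norm_num
  have hv : padicValRat 2 (((K : ℤ) : ℚ) / 4) < 0 := by
    rw [padicValRat.div (by exact_mod_cast hK0) (by norm_num), padicValRat.of_int, h4v]
    have : padicValInt 2 K < 2 := by
      by_contra hge
      push Not at hge
      exact hK2 (by simpa using ((padicValInt_dvd_iff 2 K).mpr (Or.inr hge)))
    have : (padicValInt 2 K : ℤ) < 2 := by exact_mod_cast this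
    have : ((padicValInt 2 K : ℤ) : ℚ) < 2 := by exact_mod_cast this
    linarith
  exact absurd hval (not_le.mpr hv)

end PunchFamily

end Summit.BirchSwinnertonDyer.BirchSwinnertonDyer.Theorems.ManinLocalTwoThree

end
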